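/-
Origin: expansion seat `planner-pub-hodgecm-toy2-g2-0`, handover #7 2026-08-18T05:34:05Z (`HOME/pub-hodgecm-toy2-g2/lean/Toy2g2/ToyF2.lean`, md5 09f8ed94, 242 lines);
landed by the gen-6 packager in gate run 23 as `HodgeCM/Model/Toy/ToyF2.lean` (packager added `import HodgeCM.Model.Toy.ExteriorHodge` (the file names `exteriorHodgeData`, defined there, without importing it)).
-/
-- HANDOVER (planner-pub-hodgecm-toy2-g2-0, unit pub-hodgecm-toy2-g2): WIP module `Toy2g2.ToyF2`; intended final
-- module `HodgeCM.Model.Toy.ToyF2` (kind L5, toy model / consistency witness).  Imports are FINAL package names.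
/-
Copyright: pub-hodgecm cell (HodgeCMPerL). Consistency-witness layer (part (e), referee A G4).

# F2 `Fact_factorActDescends` holds in the exterior CM-model

In the exterior model `toyModelWith D` (any Hodge datum) pull-backs are `⋀^k` of a `ℚ`-linear map of the
`H¹`-lattices, so every identity of pull-backs is decided on `H¹ = L` itself (`⋀¹` is faithful), where the
lattice of an iterated product `prodFin n X` is the direct sum of the factors' lattices and a linear map out
of it is determined by its restrictions along the projections `pr_j^*` (`prodFin_lin_ext`).  With the
factor-wise endomorphism of the SMALL product supplied by the general construction
`Universe.exists_endo_prodFin` (FactorAct.lean; here fed with the toy morphism `mulHom a`, any `a ∈ F`),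
the two descent identities of F2 are then checked summand by summand (`descent_lin`, `fixed_lin`).

Main result: `fact_factorActDescends : (toyModelWith D).Fact_factorActDescends`.  Together with
`ToyFFacts` (F4, F5, F7 hold; F6 fails) this completes the class-M audit of the geometric route's inputs
in the exterior model: everything except F6 `Fact_weightDual` is witnessed.
-/
import Summits.HodgeConjecture.HodgeCM.Model.Toy.Axioms
import Summits.HodgeConjecture.HodgeCM.Proofs.Pohlmann.FactorAct
import Summits.HodgeConjecture.HodgeCM.StubTree.Qw8Geometric
import Summits.HodgeConjecture.HodgeCM.Model.Toy.ExteriorHodge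

namespace HodgeCM.Toy

open Literature.AlgebraicGeometry.Motives
open scoped TensorProduct
open exteriorPower

noncomputable section

variable (D : HodgeData)

/-! ### `⋀¹` is faithful; linear maps out of `L (prodFin n X)` are determined along the projections -/

section linear

variable {V W : Type*} [AddCommGroup V] [Module ℚ V] [AddCommGroup W] [Module ℚ W]

/-- `⋀¹` is faithful: `⋀¹ f = ⋀¹ g → f = g`. -/
lemma lin_eq_of_map_one_eq {f g : V →ₗ[ℚ] W} (h : map 1 f = map 1 g) : f = g := by
  rw [map_one_eq, map_one_eq] at h
  refine LinearMap.ext fun v => ?_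
  have := LinearMap.congr_fun h ((oneEquiv ℚ V).symm v)
  simp only [LinearMap.coe_comp, LinearEquiv.coe_coe, Function.comp_apply,
    LinearEquiv.apply_symm_apply] at this
  exact (oneEquiv ℚ W).symm.injective this

/-- a linear map out of `L (X × Y)` is determined by its restrictions along `pr₁^*` and `pr₂^*` -/
lemma Obj.prod_lin_ext {X Y : Obj} {f g : (X.prod Y).L →ₗ[ℚ] V} (h1 : f ∘ₗ X.inlL Y = g ∘ₗ X.inlL Y)
    (h2 : f ∘ₗ X.inrL Y = g ∘ₗ X.inrL Y) : f = g := by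
  refine LinearMap.ext fun v => ?_
  have hv : v = X.inlL Y (fun i => v (Sum.inl i)) + X.inrL Y (fun i => v (Sum.inr i)) := by
    funext s
    rcases s with i | i
    · rw [Pi.add_apply, Obj.inlL_apply_inl, Obj.inrL_apply_inl, add_zero]
    · rw [Pi.add_apply, Obj.inlL_apply_inr, Obj.inrL_apply_inr, zero_add]
  rw [hv, map_add, map_add, ← LinearMap.comp_apply, h1, LinearMap.comp_apply, ← LinearMap.comp_apply f,
    h2, LinearMap.comp_apply]

end linear

/-- **Linear maps out of `L (∏_j X_j)` are determined along the projections**: if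
`f ∘ pr_j^* = g ∘ pr_j^*` on `L (X_j)` for every `j`, then `f = g`.  Induction on `n` along the left-nested
definition of `prodFin`. -/
theorem prodFin_lin_ext {V : Type*} [AddCommGroup V] [Module ℚ V] :
    ∀ (n : ℕ) (X : Fin (n + 1) → Obj) (f g : ((toyModelWith D).prodFin n X).L →ₗ[ℚ] V),
      (∀ j, f ∘ₗ ((toyModelWith D).prj n X j).lin = g ∘ₗ ((toyModelWith D).prj n X j).lin) → f = g := by
  intro n
  induction n with
  | zero =>
    intro X f g h
    have h0 := h 0
    rw [Universe.prj_zero] at h0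
    exact h0
  | succ n ih =>
    intro X f g h
    refine Obj.prod_lin_ext (X := (toyModelWith D).prodFin n fun i => X i.castSucc) (Y := X (Fin.last (n + 1)))
      ?_ ?_
    · refine ih (fun i => X i.castSucc) _ _ fun i => ?_
      have hi := h i.castSucc
      rw [Universe.prj_castSucc] at hi
      rw [LinearMap.comp_assoc, LinearMap.comp_assoc]
      exact hi
    · have hl := h (Fin.last (n + 1))
      rw [Universe.prj_last] at hl
      exact hl

/-! ### Descent of identities along a block of factors -/

section descent

variable {N n : ℕ} (Y : Fin (N + 1) → Obj) (σ : Fin (n + 1) → Fin (N + 1))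

/-- pull-back identities in degree one are identities of the lattice maps -/
lemma lin_comp_eq_of_pull_one {X Y Z : Obj} (f : Obj.Hom X Y) (g : Obj.Hom Y Z) (h : Obj.Hom X Z)
    (e : (toyModelWith D).pull (X := X) (Y := Y) f 1 ∘ₗ (toyModelWith D).pull (X := Y) (Y := Z) g 1 =
      (toyModelWith D).pull (X := X) (Y := Z) h 1) : f.lin ∘ₗ g.lin = h.lin := by
  apply lin_eq_of_map_one_eq
  rw [map_comp]
  exact e

/-- (Ported verbatim from the HodgeCMPerL package; no docstring in the source.) -/
lemma lin_comp_eq_of_pull_one' {X Y Z : Obj} (f : Obj.Hom X Y) (g : Obj.Hom Y Z) (h : Obj.Hom X Z)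
    (φ : Z.L →ₗ[ℚ] Z.L)
    (e : (toyModelWith D).pull (X := X) (Y := Y) f 1 ∘ₗ (toyModelWith D).pull (X := Y) (Y := Z) g 1 =
      (toyModelWith D).pull (X := X) (Y := Z) h 1 ∘ₗ map 1 φ) : f.lin ∘ₗ g.lin = h.lin ∘ₗ φ := by
  apply lin_eq_of_map_one_eq
  rw [map_comp, map_comp]
  exact e

/-- **Descent**: `M` acts through `φ` behind `pr_{σ j}^*` and trivially behind `pr_{σ i}^*` (`i ≠ j`),
`MA` does the same on the small product `∏_i Y_{σ i}`, and `p^*` matches the projections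
(`p^* ∘ pr_i^* = pr_{σ i}^*`); then `M^* ∘ p^* = p^* ∘ MA^*` on the lattices. -/
theorem descent_lin (hσ : Function.Injective σ)
    (p : Obj.Hom ((toyModelWith D).prodFin N Y) ((toyModelWith D).prodFin n fun i => Y (σ i)))
    (hp : ∀ i, p.lin ∘ₗ ((toyModelWith D).prj n (fun i => Y (σ i)) i).lin = ((toyModelWith D).prj N Y (σ i)).lin)
    (j : Fin (n + 1)) (φ : (Y (σ j)).L →ₗ[ℚ] (Y (σ j)).L)
    (M : Obj.Hom ((toyModelWith D).prodFin N Y) ((toyModelWith D).prodFin N Y))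
    (hMj : M.lin ∘ₗ ((toyModelWith D).prj N Y (σ j)).lin = ((toyModelWith D).prj N Y (σ j)).lin ∘ₗ φ)
    (hMi : ∀ i, i ≠ σ j → M.lin ∘ₗ ((toyModelWith D).prj N Y i).lin = ((toyModelWith D).prj N Y i).lin)
    (MA : Obj.Hom ((toyModelWith D).prodFin n fun i => Y (σ i)) ((toyModelWith D).prodFin n fun i => Y (σ i)))
    (hMAj : MA.lin ∘ₗ ((toyModelWith D).prj n (fun i => Y (σ i)) j).lin =
      ((toyModelWith D).prj n (fun i => Y (σ i)) j).lin ∘ₗ φ)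
    (hMAi : ∀ i, i ≠ j → MA.lin ∘ₗ ((toyModelWith D).prj n (fun i => Y (σ i)) i).lin =
      ((toyModelWith D).prj n (fun i => Y (σ i)) i).lin) :
    M.lin ∘ₗ p.lin = p.lin ∘ₗ MA.lin := by
  refine prodFin_lin_ext D n (fun i => Y (σ i)) _ _ fun i => ?_
  rw [LinearMap.comp_assoc, LinearMap.comp_assoc, hp i]
  by_cases hij : i = j
  · subst hij
    rw [hMj, hMAj, ← LinearMap.comp_assoc, hp i]
  · rw [hMi (σ i) (fun h => hij (hσ h)), hMAi i hij, hp i]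

/-- **Fixed block**: if `M` acts trivially behind every `pr_{σ i}^*` and `p^*` matches the projections, then
`M^* ∘ p^* = p^*` on the lattices. -/
theorem fixed_lin
    (p : Obj.Hom ((toyModelWith D).prodFin N Y) ((toyModelWith D).prodFin n fun i => Y (σ i)))
    (hp : ∀ i, p.lin ∘ₗ ((toyModelWith D).prj n (fun i => Y (σ i)) i).lin = ((toyModelWith D).prj N Y (σ i)).lin)
    (M : Obj.Hom ((toyModelWith D).prodFin N Y) ((toyModelWith D).prodFin N Y))
    (hMi : ∀ i, M.lin ∘ₗ ((toyModelWith D).prj N Y (σ i)).lin = ((toyModelWith D).prj N Y (σ i)).lin) :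
    M.lin ∘ₗ p.lin = p.lin := by
  refine prodFin_lin_ext D n (fun i => Y (σ i)) _ _ fun i => ?_
  rw [LinearMap.comp_assoc, hp i, hMi i]

end descent

/-! ### F2 -/

/-- a factor-wise action on the small product, for ANY `a ∈ F` (the toy morphism `mulHom a` extended by
`Universe.exists_endo_prodFin`), in lattice form -/
lemma exists_factorAct_lin (F : CMField) {n : ℕ} (Θ : Fin (n + 1) → CMType F) (j : Fin (n + 1)) (a : F) :
    ∃ MA : Obj.Hom ((toyModelWith D).cmProd F Θ) ((toyModelWith D).cmProd F Θ),
      (toyModelWith D).IsFactorAct F Θ j a MA ∧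
      MA.lin ∘ₗ ((toyModelWith D).prj n (fun i => (toyModelWith D).cmAV F (Θ i)) j).lin =
        ((toyModelWith D).prj n (fun i => (toyModelWith D).cmAV F (Θ i)) j).lin ∘ₗ mulK F (Θ j) a ∧
      ∀ i, i ≠ j → MA.lin ∘ₗ ((toyModelWith D).prj n (fun i => (toyModelWith D).cmAV F (Θ i)) i).lin =
        ((toyModelWith D).prj n (fun i => (toyModelWith D).cmAV F (Θ i)) i).lin := by
  obtain ⟨MA, hj, hi⟩ := Universe.exists_endo_prodFin (fact_pull_id D) (fact_pull_comp D) (fact_lift D) n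
    (fun i => (toyModelWith D).cmAV F (Θ i)) j (mulHom F (Θ j) a)
  have hj1 := hj 1
  have hι : (toyModelWith D).pull (X := cmObj F (Θ j)) (Y := cmObj F (Θ j)) (mulHom F (Θ j) a) 1 =
      (((toyModelWith D).cmAct F (Θ j)).ι a : _ →ₗ[ℚ] _) := (cmι_apply F (Θ j) a).symm
  refine ⟨MA, ⟨?_, fun i hij => hi i hij 1⟩, ?_, fun i hij => ?_⟩
  · rw [hι] at hj1
    exact hj1
  · exact lin_comp_eq_of_pull_one' D MA _ _ (mulK F (Θ j) a) hj1
  · exact lin_comp_eq_of_pull_one D MA _ _ (hi i hij 1)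

/-- lattice form of `IsFactorAct` -/
lemma isFactorAct_lin (F : CMField) {n : ℕ} (Θ : Fin (n + 1) → CMType F) (j : Fin (n + 1)) (a : F)
    (M : Obj.Hom ((toyModelWith D).cmProd F Θ) ((toyModelWith D).cmProd F Θ))
    (hM : (toyModelWith D).IsFactorAct F Θ j a M) :
    M.lin ∘ₗ ((toyModelWith D).prj n (fun i => (toyModelWith D).cmAV F (Θ i)) j).lin =
        ((toyModelWith D).prj n (fun i => (toyModelWith D).cmAV F (Θ i)) j).lin ∘ₗ mulK F (Θ j) a ∧
      ∀ i, i ≠ j → M.lin ∘ₗ ((toyModelWith D).prj n (fun i => (toyModelWith D).cmAV F (Θ i)) i).lin =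
        ((toyModelWith D).prj n (fun i => (toyModelWith D).cmAV F (Θ i)) i).lin := by
  obtain ⟨hj, hi⟩ := hM
  have e : (((toyModelWith D).cmAct F (Θ j)).ι a : _ →ₗ[ℚ] _) = map 1 (mulK F (Θ j) a) := cmι_apply F (Θ j) a
  exact ⟨lin_comp_eq_of_pull_one' D M _ _ (mulK F (Θ j) a) (hj.trans (congrArg _ e)),
    fun i hij => lin_comp_eq_of_pull_one D M _ _ (hi i hij)⟩

/-- lattice form of `IsBlockPair` -/
lemma isBlockPair_lin (F : CMField) {n m : ℕ} (Ξ : Fin (n + 1 + (m + 1)) → CMType F)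
    (pA : Obj.Hom ((toyModelWith D).cmProd F Ξ) ((toyModelWith D).cmProd F (blkA Ξ)))
    (pB : Obj.Hom ((toyModelWith D).cmProd F Ξ) ((toyModelWith D).cmProd F (blkB Ξ)))
    (h : (toyModelWith D).IsBlockPair F Ξ pA pB) :
    (∀ j, pA.lin ∘ₗ ((toyModelWith D).prj n (fun j => (toyModelWith D).cmAV F (blkA Ξ j)) j).lin =
        ((toyModelWith D).prj (n + 1 + m) (fun k => (toyModelWith D).cmAV F (Ξ k)) (Fin.castAdd (m + 1) j)).lin) ∧
      ∀ i, pB.lin ∘ₗ ((toyModelWith D).prj m (fun i => (toyModelWith D).cmAV F (blkB Ξ i)) i).lin =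
        ((toyModelWith D).prj (n + 1 + m) (fun k => (toyModelWith D).cmAV F (Ξ k)) (Fin.natAdd (n + 1) i)).lin :=
  ⟨fun j => lin_comp_eq_of_pull_one D pA _ _ (h.1 j 1), fun i => lin_comp_eq_of_pull_one D pB _ _ (h.2 i 1)⟩

/-- (Ported verbatim from the HodgeCMPerL package; no docstring in the source.) -/
lemma castAdd_ne_natAdd {n m : ℕ} (j : Fin (n + 1)) (i : Fin (m + 1)) :
    Fin.castAdd (m + 1) j ≠ Fin.natAdd (n + 1) i := by
  intro h
  have := congrArg Fin.val h
  simp only [Fin.val_castAdd, Fin.val_natAdd] at this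
  omega

/-- **F2 in the exterior model** (any Hodge datum): factor-wise CM actions on a concatenated product
descend to the two blocks. -/
theorem fact_factorActDescends : (toyModelWith D).Fact_factorActDescends := by
  intro F n m Ξ pA pB hP a M
  obtain ⟨hpA, hpB⟩ := isBlockPair_lin D F Ξ pA pB hP
  have pull_comm : ∀ {X Y : Obj} (f : Obj.Hom X Y) (g : Obj.Hom Y Y) (h : Obj.Hom X X),
      h.lin ∘ₗ f.lin = f.lin ∘ₗ g.lin → ∀ k : ℕ,
        (toyModelWith D).pull (X := X) (Y := X) h k ∘ₗ (toyModelWith D).pull (X := X) (Y := Y) f k =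
          (toyModelWith D).pull (X := X) (Y := Y) f k ∘ₗ (toyModelWith D).pull (X := Y) (Y := Y) g k := by
    intro X Y f g h e k
    show map k h.lin ∘ₗ map k f.lin = map k f.lin ∘ₗ map k g.lin
    rw [← map_comp, ← map_comp, e]
  have pull_fix : ∀ {X Y : Obj} (f : Obj.Hom X Y) (h : Obj.Hom X X), h.lin ∘ₗ f.lin = f.lin → ∀ k : ℕ,
      (toyModelWith D).pull (X := X) (Y := X) h k ∘ₗ (toyModelWith D).pull (X := X) (Y := Y) f k =
        (toyModelWith D).pull (X := X) (Y := Y) f k := by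
    intro X Y f h e k
    show map k h.lin ∘ₗ map k f.lin = map k f.lin
    rw [← map_comp, e]
  constructor
  · intro j hM
    obtain ⟨hMj, hMi⟩ := isFactorAct_lin D F Ξ (Fin.castAdd (m + 1) j) a M hM
    obtain ⟨MA, hMA, hMAj, hMAi⟩ := exists_factorAct_lin D F (blkA Ξ) j a
    refine ⟨⟨MA, hMA, pull_comm pA MA M ?_⟩, pull_fix pB M ?_⟩
    · exact descent_lin D (fun k => (toyModelWith D).cmAV F (Ξ k)) (Fin.castAdd (m + 1))
        (Fin.castAdd_injective _ _) pA hpA j (mulK F (Ξ (Fin.castAdd (m + 1) j)) a) M hMj hMi MA hMAj hMAi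
    · exact fixed_lin D (fun k => (toyModelWith D).cmAV F (Ξ k)) (Fin.natAdd (n + 1)) pB hpB M
        fun i => hMi _ (castAdd_ne_natAdd j i).symm
  · intro i hM
    obtain ⟨hMj, hMi⟩ := isFactorAct_lin D F Ξ (Fin.natAdd (n + 1) i) a M hM
    obtain ⟨MB, hMB, hMBj, hMBi⟩ := exists_factorAct_lin D F (blkB Ξ) i a
    refine ⟨⟨MB, hMB, pull_comm pB MB M ?_⟩, pull_fix pA M ?_⟩
    · exact descent_lin D (fun k => (toyModelWith D).cmAV F (Ξ k)) (Fin.natAdd (n + 1))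
        (Fin.natAdd_injective _ _) pB hpB i (mulK F (Ξ (Fin.natAdd (n + 1) i)) a) M hMj hMi MB hMBj hMBi
    · exact fixed_lin D (fun k => (toyModelWith D).cmAV F (Ξ k)) (Fin.castAdd (m + 1)) pA hpA M
        fun j => hMi _ (castAdd_ne_natAdd j i)

/-- F2 for `toyModel`'s underlying family, exterior Hodge datum. -/
theorem fact_factorActDescends_exterior : (toyModelWith exteriorHodgeData).Fact_factorActDescends :=
  fact_factorActDescends _

end

end HodgeCM.Toy
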